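import Mathlib
import HarnessLib
import Summits.HubbardSuperconductivity.HubbardSuperconductivity.Theorems.KLProgrammeC4aPPKernelTwoScale
import Summits.HubbardSuperconductivity.HubbardSuperconductivity.Theorems.KLProgrammeC4aPPKernelTrueFlatnessShape

/-!
# Route `KLProgramme` — crux C4a, S3 brick (B4) «(B4)-UMK1», «(M1)-TRUE-KERNEL» adaptation (a): the terms of the slice kernel carrying a UV-SCALE weight
# `W_{Λ′}` are SMOOTH — uniform gradient `≤ (6B₁ + 19/6)/Λ′`, flatness number `≤ (6B₁ + 19/6)(2κ₀ + κ₁)/Λ′` on every line `D ≤ Λ′/4` (the `A₃` slot)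

Cell `gate-hubbard-kl`, seat hubbard-kl-k3c3-p1 (g15; row «δμ-flow with klAngularMean constant piece»).  Companion of `…C4aPPKernelTwoScale` / `…TrueFlatnessShape`
(stub (C) of stmt-HubbardSuperconductivity-20437; (U1) chain of hubbard-kl-k3c3-p3; note `M1-TRUE-KERNEL.md` §4 (a)).  With slice lines `W_Λ − W_{Λ′}` the pair numerator
splits into `N_{Λ,Λ} − N_{Λ,Λ′} − N_{Λ′,Λ} + N_{Λ′,Λ′}`; the first term is `…TrueFlatnessShape`'s (`A₁·lo/max(D,lo)²`); this file shows the other three are harmless on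
the lines that matter (`D ≤ Λ′/4`, i.e. both levels below the UV quarter shell): a weight `W_{Λ′}(ωₙ,x)` with `x² ≤ Λ′²/16` is nonzero only for `ωₙ² ≥ 3Λ′²/16`, where
every Lorentzian factor is `O(1/ωₙ²)` — no small denominators, no cancellation needed.
* §1 `sq_ge_of_uvWeightFn_ne_zero_uv` (`W_{Λ₂}(ω,u) ≠ 0`, `u² ≤ Λ₂²/16` ⟹ `3Λ₂²/16 ≤ ω²`), the per-summand majorants, and the UNIFORM GRADIENT BOUNDS
  **`abs_ppTwoScaleNumeratorDu_le_uv`** (`|∂ᵤN_{Λ₁,Λ₂}(e,u)| ≤ (6B₁+19/6)/Λ₂` for `u² ≤ Λ₂²/16`, all `e`) and **`abs_ppTwoScaleNumeratorDe_le_uv`**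
  (`|∂ₑN_{Λ₁,Λ₂}(e,u)| ≤ (6B₁+19/6)/Λ₂` for `u² ≤ Λ₂²/16`, all `e`; `Λ₁ > 0` arbitrary);
* §2 `ppTwoScaleNumerator_zero_zero`, **`abs_ppTwoScaleNumerator_le_sum_uv`** (`|N_{Λ₁,Λ₂}(e,u)| ≤ (6B₁+19/6)(e+u)/Λ₂` for `0 ≤ e`, `0 ≤ u ≤ Λ₂/4`);
* §3 **`twoScaleKernel_antidiagonal_flatness_uv_partner_le`** (`N = N_{Λ₁,Λ₂}`, UV weight on the partner) and **`…_uv_loop_le`** (`N = N_{Λ₂,Λ₁}`, UV weight on the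
  loop line): for every `0 < D ≤ Λ₂/4`, `|∫_0^D ∂ᵤK(e,D−e) de| ≤ (6B₁+19/6)(2κ₀+κ₁)/Λ₂` — an n-free CONSTANT (`Λ₂ = Λ′` fixed), the `A₃` slot of
  `…C4aPreCausticAngleLayer.intervalIntegral_pre_caustic_angle_le`.
Pure real analysis; nothing asserts (C), K3 or superconductivity.
References: BGM 2006 §2.1, §2.4 [cite: BenfattoGiulianiMastropietro2006]; Salmhofer 1999 §4.2.5 (4.70)–(4.71) [cite: Salmhofer1999]; FST II CPAM 51 (1998) §3
[cite: FeldmanSalmhoferTrubowitz1998].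
-/

noncomputable section

namespace Summit.HubbardSuperconductivity.HubbardSuperconductivity.Theorems.C4a

set_option linter.dupNamespace false -- summit = problem name (single-conjunct summit), D-0017

open Real Filter Set MeasureTheory intervalIntegral
open scoped Topology Interval
open Literature.MathematicalPhysics.QuantumLattice Literature.Analysis.SpecialFunctions

/-! ## §1 Below the UV quarter shell only high frequencies carry the UV weight -/

/-- `W_{Λ₂}(ω,u) ≠ 0` with `u² ≤ Λ₂²/16` forces `3Λ₂²/16 ≤ ω²`. [cite: Salmhofer1999, §4.2.5 (4.71)] -/
theorem sq_ge_of_uvWeightFn_ne_zero_uv {Λ₂ : ℝ} (hΛ₂ : 0 < Λ₂) {ω u : ℝ} (hu : u ^ 2 ≤ Λ₂ ^ 2 / 16) (hW : uvWeightFn Λ₂ ω u ≠ 0) :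
    3 * Λ₂ ^ 2 / 16 ≤ ω ^ 2 := by
  have h := sq_add_sq_ge_of_uvWeightFn_ne_zero hΛ₂ hW
  linarith

/-- `W′_{Λ₂}(ω,u) ≠ 0` with `u² ≤ Λ₂²/16` forces `3Λ₂²/16 ≤ ω²`. [cite: Salmhofer1999, §4.2.5 (4.71)] -/
theorem sq_ge_of_uvWeightFnD1_ne_zero_uv {Λ₂ : ℝ} (hΛ₂ : 0 < Λ₂) {ω u : ℝ} (hu : u ^ 2 ≤ Λ₂ ^ 2 / 16) (hW : uvWeightFnD1 Λ₂ ω u ≠ 0) :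
    3 * Λ₂ ^ 2 / 16 ≤ ω ^ 2 := by
  by_contra h
  have hlt : u ^ 2 + ω ^ 2 < Λ₂ ^ 2 / 4 := by linarith [not_le.1 h]
  exact hW (uvWeightFn_eq_zero_of_lt hΛ₂ hlt).2.1

/-- High frequency ⟹ `1/ω² ≤ (19/3)/(ω² + Λ₂²)` and `1/ω ≤ 3/Λ₂`. [folklore] -/
theorem inv_sq_le_of_sq_ge {Λ₂ ω : ℝ} (hΛ₂ : 0 < Λ₂) (hω : 3 * Λ₂ ^ 2 / 16 ≤ ω ^ 2) :
    1 / ω ^ 2 ≤ 19 / 3 / (ω ^ 2 + Λ₂ ^ 2) ∧ (0 < ω → 1 / ω ≤ 3 / Λ₂) := by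
  have hω2 : 0 < ω ^ 2 := by nlinarith [pow_pos hΛ₂ 2]
  refine ⟨?_, fun hωpos => ?_⟩
  · rw [div_le_div_iff₀ hω2 (by positivity)]; nlinarith
  · rw [div_le_div_iff₀ hωpos hΛ₂]; nlinarith [sq_nonneg (3 * ω - Λ₂)]

/-- Per summand, partner derivative: `|W_{Λ₁}(ω,e)·[W′_{Λ₂}(ω,u)(L e + L u) + W_{Λ₂}(ω,u)·∂L u]| ≤ (12B₁ + 19/3)/(ω² + Λ₂²)` for `u² ≤ Λ₂²/16`, `ω > 0`.
[cite: BenfattoGiulianiMastropietro2006, §2.4 (2.36)] -/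
theorem abs_twoScaleDuSummand_le_uv {B₁ : ℝ} (hB₁ : ∀ x, |deriv salmhoferCutoff x| ≤ B₁) {Λ₁ Λ₂ : ℝ} (hΛ₂ : 0 < Λ₂) {ω : ℝ} (hω : 0 < ω)
    (e : ℝ) {u : ℝ} (hu : u ^ 2 ≤ Λ₂ ^ 2 / 16) :
    |uvWeightFn Λ₁ ω e * (uvWeightFnD1 Λ₂ ω u * (e / (ω ^ 2 + e ^ 2) + u / (ω ^ 2 + u ^ 2)) + uvWeightFn Λ₂ ω u * ((ω ^ 2 - u ^ 2) / (ω ^ 2 + u ^ 2) ^ 2))| ≤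
      (12 * B₁ + 19 / 3) / (ω ^ 2 + Λ₂ ^ 2) := by
  have hB0 := salmhoferB₁_nonneg hB₁
  have hWe : |uvWeightFn Λ₁ ω e| ≤ 1 := abs_uvWeightFn_le_one _ _ _
  -- the cutoff-derivative piece
  have h1 : |uvWeightFnD1 Λ₂ ω u * (e / (ω ^ 2 + e ^ 2) + u / (ω ^ 2 + u ^ 2))| ≤ 12 * B₁ / (ω ^ 2 + Λ₂ ^ 2) := by
    by_cases hD : uvWeightFnD1 Λ₂ ω u = 0
    · rw [hD, zero_mul, abs_zero]; positivity
    · have hωsq := sq_ge_of_uvWeightFnD1_ne_zero_uv hΛ₂ hu hD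
      have hinv := ((inv_sq_le_of_sq_ge hΛ₂ hωsq).2 hω)
      have hL : |e / (ω ^ 2 + e ^ 2) + u / (ω ^ 2 + u ^ 2)| ≤ 3 / Λ₂ := by
        refine (abs_add_le _ _).trans ?_
        calc |e / (ω ^ 2 + e ^ 2)| + |u / (ω ^ 2 + u ^ 2)| ≤ 1 / (2 * ω) + 1 / (2 * ω) :=
              add_le_add (abs_lorentzian_le_half_inv hω e) (abs_lorentzian_le_half_inv hω u)
          _ = 1 / ω := by field_simp; ring
          _ ≤ 3 / Λ₂ := hinv
      rw [abs_mul]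
      calc |uvWeightFnD1 Λ₂ ω u| * |e / (ω ^ 2 + e ^ 2) + u / (ω ^ 2 + u ^ 2)| ≤ 2 * B₁ / Λ₂ * (2 * Λ₂ ^ 2 / (ω ^ 2 + Λ₂ ^ 2)) * (3 / Λ₂) :=
            mul_le_mul (abs_uvWeightFnD1_le_shell hB₁ hΛ₂ ω u) hL (abs_nonneg _) (by positivity)
        _ = 12 * B₁ / (ω ^ 2 + Λ₂ ^ 2) := by field_simp; ring
  -- the weighted Lorentzian-derivative piece
  have h2 : |uvWeightFn Λ₂ ω u * ((ω ^ 2 - u ^ 2) / (ω ^ 2 + u ^ 2) ^ 2)| ≤ 19 / 3 / (ω ^ 2 + Λ₂ ^ 2) := by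
    by_cases hW : uvWeightFn Λ₂ ω u = 0
    · rw [hW, zero_mul, abs_zero]; positivity
    · have hωsq := sq_ge_of_uvWeightFn_ne_zero_uv hΛ₂ hu hW
      have hinv := (inv_sq_le_of_sq_ge hΛ₂ hωsq).1
      rw [abs_mul]
      calc |uvWeightFn Λ₂ ω u| * |(ω ^ 2 - u ^ 2) / (ω ^ 2 + u ^ 2) ^ 2| ≤ 1 * (1 / ω ^ 2) :=
            mul_le_mul (abs_uvWeightFn_le_one _ _ _) (abs_lorentzian_deriv_le hω.ne' u) (abs_nonneg _) zero_le_one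
        _ = 1 / ω ^ 2 := one_mul _
        _ ≤ 19 / 3 / (ω ^ 2 + Λ₂ ^ 2) := hinv
  rw [abs_mul]
  calc |uvWeightFn Λ₁ ω e| * |uvWeightFnD1 Λ₂ ω u * (e / (ω ^ 2 + e ^ 2) + u / (ω ^ 2 + u ^ 2)) + uvWeightFn Λ₂ ω u * ((ω ^ 2 - u ^ 2) / (ω ^ 2 + u ^ 2) ^ 2)|
      ≤ 1 * (12 * B₁ / (ω ^ 2 + Λ₂ ^ 2) + 19 / 3 / (ω ^ 2 + Λ₂ ^ 2)) :=
        mul_le_mul hWe ((abs_add_le _ _).trans (add_le_add h1 h2)) (abs_nonneg _) zero_le_one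
    _ = (12 * B₁ + 19 / 3) / (ω ^ 2 + Λ₂ ^ 2) := by rw [one_mul, ← add_div]

/-- Per summand, loop derivative with the UV weight on the partner: `|W_{Λ₂}(ω,u)·[W′_{Λ₁}(ω,e)(L u + L e) + W_{Λ₁}(ω,e)·∂L e]| ≤
12B₁Λ₁/(Λ₂(ω² + Λ₁²)) + (19/3)/(ω² + Λ₂²)` for `u² ≤ Λ₂²/16`, `ω > 0`, `Λ₁, Λ₂ > 0`. [cite: BenfattoGiulianiMastropietro2006, §2.4 (2.36)] -/
theorem abs_twoScaleDeSummand_le_uv {B₁ : ℝ} (hB₁ : ∀ x, |deriv salmhoferCutoff x| ≤ B₁) {Λ₁ Λ₂ : ℝ} (hΛ₁ : 0 < Λ₁) (hΛ₂ : 0 < Λ₂) {ω : ℝ} (hω : 0 < ω)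
    (e : ℝ) {u : ℝ} (hu : u ^ 2 ≤ Λ₂ ^ 2 / 16) :
    |uvWeightFn Λ₂ ω u * (uvWeightFnD1 Λ₁ ω e * (u / (ω ^ 2 + u ^ 2) + e / (ω ^ 2 + e ^ 2)) + uvWeightFn Λ₁ ω e * ((ω ^ 2 - e ^ 2) / (ω ^ 2 + e ^ 2) ^ 2))| ≤
      12 * B₁ * Λ₁ / (Λ₂ * (ω ^ 2 + Λ₁ ^ 2)) + 19 / 3 / (ω ^ 2 + Λ₂ ^ 2) := by
  have hB0 := salmhoferB₁_nonneg hB₁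
  by_cases hW : uvWeightFn Λ₂ ω u = 0
  · rw [hW, zero_mul, abs_zero]; positivity
  have hωsq := sq_ge_of_uvWeightFn_ne_zero_uv hΛ₂ hu hW
  have hinv := inv_sq_le_of_sq_ge hΛ₂ hωsq
  have hL : |u / (ω ^ 2 + u ^ 2) + e / (ω ^ 2 + e ^ 2)| ≤ 3 / Λ₂ := by
    refine (abs_add_le _ _).trans ?_
    calc |u / (ω ^ 2 + u ^ 2)| + |e / (ω ^ 2 + e ^ 2)| ≤ 1 / (2 * ω) + 1 / (2 * ω) :=
          add_le_add (abs_lorentzian_le_half_inv hω u) (abs_lorentzian_le_half_inv hω e)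
      _ = 1 / ω := by field_simp; ring
      _ ≤ 3 / Λ₂ := hinv.2 hω
  have h1 : |uvWeightFnD1 Λ₁ ω e * (u / (ω ^ 2 + u ^ 2) + e / (ω ^ 2 + e ^ 2))| ≤ 12 * B₁ * Λ₁ / (Λ₂ * (ω ^ 2 + Λ₁ ^ 2)) := by
    rw [abs_mul]
    calc |uvWeightFnD1 Λ₁ ω e| * |u / (ω ^ 2 + u ^ 2) + e / (ω ^ 2 + e ^ 2)| ≤ 2 * B₁ / Λ₁ * (2 * Λ₁ ^ 2 / (ω ^ 2 + Λ₁ ^ 2)) * (3 / Λ₂) :=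
          mul_le_mul (abs_uvWeightFnD1_le_shell hB₁ hΛ₁ ω e) hL (abs_nonneg _) (by positivity)
      _ = 12 * B₁ * Λ₁ / (Λ₂ * (ω ^ 2 + Λ₁ ^ 2)) := by field_simp; ring
  have h2 : |uvWeightFn Λ₁ ω e * ((ω ^ 2 - e ^ 2) / (ω ^ 2 + e ^ 2) ^ 2)| ≤ 19 / 3 / (ω ^ 2 + Λ₂ ^ 2) := by
    rw [abs_mul]
    calc |uvWeightFn Λ₁ ω e| * |(ω ^ 2 - e ^ 2) / (ω ^ 2 + e ^ 2) ^ 2| ≤ 1 * (1 / ω ^ 2) :=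
          mul_le_mul (abs_uvWeightFn_le_one _ _ _) (abs_lorentzian_deriv_le hω.ne' e) (abs_nonneg _) zero_le_one
      _ = 1 / ω ^ 2 := one_mul _
      _ ≤ 19 / 3 / (ω ^ 2 + Λ₂ ^ 2) := hinv.1
  rw [abs_mul]
  calc |uvWeightFn Λ₂ ω u| * |uvWeightFnD1 Λ₁ ω e * (u / (ω ^ 2 + u ^ 2) + e / (ω ^ 2 + e ^ 2)) + uvWeightFn Λ₁ ω e * ((ω ^ 2 - e ^ 2) / (ω ^ 2 + e ^ 2) ^ 2)|
      ≤ 1 * (12 * B₁ * Λ₁ / (Λ₂ * (ω ^ 2 + Λ₁ ^ 2)) + 19 / 3 / (ω ^ 2 + Λ₂ ^ 2)) :=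
        mul_le_mul (abs_uvWeightFn_le_one _ _ _) ((abs_add_le _ _).trans (add_le_add h1 h2)) (abs_nonneg _) zero_le_one
    _ = _ := one_mul _

/-- **UV gradient bound, partner derivative**: `u² ≤ Λ₂²/16 ⟹ |∂ᵤN_{Λ₁,Λ₂}(e,u)| ≤ (6B₁ + 19/6)/Λ₂` for every `e`.
[cite: BenfattoGiulianiMastropietro2006, §2.4 (2.36)] -/
theorem abs_ppTwoScaleNumeratorDu_le_uv {β Λ₁ Λ₂ : ℝ} (hβ : 0 < β) (hΛ₂ : 0 < Λ₂) {B₁ : ℝ} (hB₁ : ∀ x, |deriv salmhoferCutoff x| ≤ B₁)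
    (e : ℝ) {u : ℝ} (hu : u ^ 2 ≤ Λ₂ ^ 2 / 16) :
    |ppTwoScaleNumeratorDu β Λ₁ Λ₂ e u| ≤ (6 * B₁ + 19 / 6) / Λ₂ := by
  have hB0 := salmhoferB₁_nonneg hB₁
  have hω : ∀ n : ℕ, 0 < ppFreq β n := ppFreq_pos hβ
  unfold ppTwoScaleNumeratorDu
  set f : ℕ → ℝ := fun n => uvWeightFn Λ₁ (ppFreq β n) e *
    (uvWeightFnD1 Λ₂ (ppFreq β n) u * (e / (ppFreq β n ^ 2 + e ^ 2) + u / (ppFreq β n ^ 2 + u ^ 2)) +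
      uvWeightFn Λ₂ (ppFreq β n) u * ((ppFreq β n ^ 2 - u ^ 2) / (ppFreq β n ^ 2 + u ^ 2) ^ 2)) with hf
  have hbd : ∀ n, |f n| ≤ (12 * B₁ + 19 / 3) * (1 / (ppFreq β n ^ 2 + Λ₂ ^ 2)) := fun n => by
    rw [← div_eq_mul_one_div]; exact abs_twoScaleDuSummand_le_uv hB₁ hΛ₂ (hω n) e hu
  have hsb : Summable fun n : ℕ => (12 * B₁ + 19 / 3) * (1 / (ppFreq β n ^ 2 + Λ₂ ^ 2)) := (summable_one_div_ppFreq_sq_add_sq hβ Λ₂).mul_left _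
  have hsf : Summable f := Summable.of_norm_bounded hsb fun n => by rw [Real.norm_eq_abs]; exact hbd n
  have htsum : |∑' n : ℕ, f n| ≤ (12 * B₁ + 19 / 3) * (β * Real.tanh (β * Λ₂ / 2) / (4 * Λ₂)) := by
    rw [← tsum_one_div_ppFreq_sq_add_sq hβ hΛ₂.ne', ← tsum_mul_left]
    refine (norm_tsum_le_tsum_norm hsf.norm).trans ?_
    exact Summable.tsum_le_tsum (fun n => by rw [Real.norm_eq_abs]; exact hbd n) hsf.norm hsb
  have ht : Real.tanh (β * Λ₂ / 2) ≤ 1 := (Real.tanh_lt_one _).le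
  have hβ2 : 0 < 2 / β := by positivity
  rw [abs_mul, abs_of_pos hβ2]
  calc 2 / β * |∑' n : ℕ, f n| ≤ 2 / β * ((12 * B₁ + 19 / 3) * (β * Real.tanh (β * Λ₂ / 2) / (4 * Λ₂))) := mul_le_mul_of_nonneg_left htsum hβ2.le
    _ = (6 * B₁ + 19 / 6) / Λ₂ * Real.tanh (β * Λ₂ / 2) := by field_simp; ring
    _ ≤ (6 * B₁ + 19 / 6) / Λ₂ * 1 := mul_le_mul_of_nonneg_left ht (by positivity)
    _ = (6 * B₁ + 19 / 6) / Λ₂ := mul_one _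

/-- **UV gradient bound, loop derivative**: `u² ≤ Λ₂²/16 ⟹ |∂ₑN_{Λ₁,Λ₂}(e,u)| = |ppTwoScaleNumeratorDu β Λ₂ Λ₁ u e| ≤ (6B₁ + 19/6)/Λ₂` for every `e`.
[cite: BenfattoGiulianiMastropietro2006, §2.4 (2.36)] -/
theorem abs_ppTwoScaleNumeratorDe_le_uv {β Λ₁ Λ₂ : ℝ} (hβ : 0 < β) (hΛ₁ : 0 < Λ₁) (hΛ₂ : 0 < Λ₂) {B₁ : ℝ} (hB₁ : ∀ x, |deriv salmhoferCutoff x| ≤ B₁)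
    (e : ℝ) {u : ℝ} (hu : u ^ 2 ≤ Λ₂ ^ 2 / 16) :
    |ppTwoScaleNumeratorDu β Λ₂ Λ₁ u e| ≤ (6 * B₁ + 19 / 6) / Λ₂ := by
  have hB0 := salmhoferB₁_nonneg hB₁
  have hω : ∀ n : ℕ, 0 < ppFreq β n := ppFreq_pos hβ
  unfold ppTwoScaleNumeratorDu
  set f : ℕ → ℝ := fun n => uvWeightFn Λ₂ (ppFreq β n) u *
    (uvWeightFnD1 Λ₁ (ppFreq β n) e * (u / (ppFreq β n ^ 2 + u ^ 2) + e / (ppFreq β n ^ 2 + e ^ 2)) +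
      uvWeightFn Λ₁ (ppFreq β n) e * ((ppFreq β n ^ 2 - e ^ 2) / (ppFreq β n ^ 2 + e ^ 2) ^ 2)) with hf
  set g : ℕ → ℝ := fun n => 12 * B₁ * Λ₁ / Λ₂ * (1 / (ppFreq β n ^ 2 + Λ₁ ^ 2)) + 19 / 3 * (1 / (ppFreq β n ^ 2 + Λ₂ ^ 2)) with hg
  have hbd : ∀ n, |f n| ≤ g n := fun n => by
    have h := abs_twoScaleDeSummand_le_uv hB₁ hΛ₁ hΛ₂ (hω n) e hu
    refine h.trans (le_of_eq ?_)
    simp only [hg]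
    field_simp
  have hsg : Summable g := ((summable_one_div_ppFreq_sq_add_sq hβ Λ₁).mul_left _).add ((summable_one_div_ppFreq_sq_add_sq hβ Λ₂).mul_left _)
  have hsf : Summable f := Summable.of_norm_bounded hsg fun n => by rw [Real.norm_eq_abs]; exact hbd n
  have htsum : |∑' n : ℕ, f n| ≤ 12 * B₁ * Λ₁ / Λ₂ * (β * Real.tanh (β * Λ₁ / 2) / (4 * Λ₁)) + 19 / 3 * (β * Real.tanh (β * Λ₂ / 2) / (4 * Λ₂)) := by
    rw [← tsum_one_div_ppFreq_sq_add_sq hβ hΛ₁.ne', ← tsum_one_div_ppFreq_sq_add_sq hβ hΛ₂.ne', ← tsum_mul_left, ← tsum_mul_left,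
      ← ((summable_one_div_ppFreq_sq_add_sq hβ Λ₁).mul_left _).tsum_add ((summable_one_div_ppFreq_sq_add_sq hβ Λ₂).mul_left _)]
    refine (norm_tsum_le_tsum_norm hsf.norm).trans ?_
    exact Summable.tsum_le_tsum (fun n => by rw [Real.norm_eq_abs]; exact hbd n) hsf.norm hsg
  have ht₁ : Real.tanh (β * Λ₁ / 2) ≤ 1 := (Real.tanh_lt_one _).le
  have ht₂ : Real.tanh (β * Λ₂ / 2) ≤ 1 := (Real.tanh_lt_one _).le
  have hβ2 : 0 < 2 / β := by positivity
  rw [abs_mul, abs_of_pos hβ2]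
  calc 2 / β * |∑' n : ℕ, f n|
      ≤ 2 / β * (12 * B₁ * Λ₁ / Λ₂ * (β * Real.tanh (β * Λ₁ / 2) / (4 * Λ₁)) + 19 / 3 * (β * Real.tanh (β * Λ₂ / 2) / (4 * Λ₂))) :=
        mul_le_mul_of_nonneg_left htsum hβ2.le
    _ = 6 * B₁ / Λ₂ * Real.tanh (β * Λ₁ / 2) + 19 / 6 / Λ₂ * Real.tanh (β * Λ₂ / 2) := by field_simp; ring
    _ ≤ 6 * B₁ / Λ₂ * 1 + 19 / 6 / Λ₂ * 1 := add_le_add (mul_le_mul_of_nonneg_left ht₁ (by positivity)) (mul_le_mul_of_nonneg_left ht₂ (by positivity))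
    _ = (6 * B₁ + 19 / 6) / Λ₂ := by ring

/-! ## §2 Size of the two-scale numerator near the origin -/

/-- `N_{Λ₁,Λ₂}(0,0) = 0`. [folklore] -/
theorem ppTwoScaleNumerator_zero_zero (β Λ₁ Λ₂ : ℝ) : ppTwoScaleNumerator β Λ₁ Λ₂ 0 0 = 0 := by
  unfold ppTwoScaleNumerator
  simp

/-- **`|N_{Λ₁,Λ₂}(e,u)| ≤ (6B₁+19/6)(e+u)/Λ₂`** for `0 ≤ e` and `0 ≤ u ≤ Λ₂/4` (two mean-value steps). [cite: BenfattoGiulianiMastropietro2006, §2.4 (2.36)] -/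
theorem abs_ppTwoScaleNumerator_le_sum_uv {β Λ₁ Λ₂ : ℝ} (hβ : 0 < β) (hΛ₁ : 0 < Λ₁) (hΛ₂ : 0 < Λ₂) {B₁ : ℝ} (hB₁ : ∀ x, |deriv salmhoferCutoff x| ≤ B₁)
    {e u : ℝ} (he : 0 ≤ e) (hu : 0 ≤ u) (huΛ : u ≤ Λ₂ / 4) :
    |ppTwoScaleNumerator β Λ₁ Λ₂ e u| ≤ (6 * B₁ + 19 / 6) / Λ₂ * (e + u) := by
  set S : ℝ := (6 * B₁ + 19 / 6) / Λ₂ with hS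
  have husq : ∀ v ∈ Icc (0 : ℝ) u, v ^ 2 ≤ Λ₂ ^ 2 / 16 := fun v hv => by nlinarith [hv.1, hv.2, huΛ]
  have h1 : ‖ppTwoScaleNumerator β Λ₁ Λ₂ 0 u - ppTwoScaleNumerator β Λ₁ Λ₂ 0 0‖ ≤ S * (u - 0) :=
    norm_image_sub_le_of_norm_deriv_le_segment' (f := fun v => ppTwoScaleNumerator β Λ₁ Λ₂ 0 v) (f' := fun v => ppTwoScaleNumeratorDu β Λ₁ Λ₂ 0 v)
      (fun v _ => (hasDerivAt_ppTwoScaleNumerator_u hβ hΛ₂ hB₁ 0 v).hasDerivWithinAt)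
      (fun v hv => by rw [Real.norm_eq_abs]; exact abs_ppTwoScaleNumeratorDu_le_uv hβ hΛ₂ hB₁ 0 (husq v (Ico_subset_Icc_self hv))) u (right_mem_Icc.2 hu)
  have hu16 : u ^ 2 ≤ Λ₂ ^ 2 / 16 := husq u (right_mem_Icc.2 hu)
  have h2 : ‖ppTwoScaleNumerator β Λ₁ Λ₂ e u - ppTwoScaleNumerator β Λ₁ Λ₂ 0 u‖ ≤ S * (e - 0) :=
    norm_image_sub_le_of_norm_deriv_le_segment' (f := fun x => ppTwoScaleNumerator β Λ₁ Λ₂ x u) (f' := fun x => ppTwoScaleNumeratorDu β Λ₂ Λ₁ u x)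
      (fun x _ => (hasDerivAt_ppTwoScaleNumerator_e hβ hΛ₁ hB₁ x u).hasDerivWithinAt)
      (fun x _ => by rw [Real.norm_eq_abs]; exact abs_ppTwoScaleNumeratorDe_le_uv hβ hΛ₁ hΛ₂ hB₁ x hu16) e (right_mem_Icc.2 he)
  rw [ppTwoScaleNumerator_zero_zero, sub_zero, Real.norm_eq_abs] at h1
  rw [Real.norm_eq_abs, sub_zero] at h2
  calc |ppTwoScaleNumerator β Λ₁ Λ₂ e u| = |(ppTwoScaleNumerator β Λ₁ Λ₂ e u - ppTwoScaleNumerator β Λ₁ Λ₂ 0 u) + ppTwoScaleNumerator β Λ₁ Λ₂ 0 u| := by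
        rw [sub_add_cancel]
    _ ≤ |ppTwoScaleNumerator β Λ₁ Λ₂ e u - ppTwoScaleNumerator β Λ₁ Λ₂ 0 u| + |ppTwoScaleNumerator β Λ₁ Λ₂ 0 u| := abs_add_le _ _
    _ ≤ S * e + S * (u - 0) := add_le_add h2 h1
    _ = S * (e + u) := by ring

/-! ## §3 The flatness number of the UV-weighted terms on every line `D ≤ Λ₂/4` -/

/-- **UV term, UV weight on the PARTNER line** (`N = N_{Λ₁,Λ₂}`): for `0 < D ≤ Λ₂/4` and `|κ| ≤ κ₀`, `|κ′| ≤ κ₁` on `[0,1]`,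
`|∫_0^D [∂ᵤN(e,D−e)κ(e/D)/D − N(e,D−e)(κ′(e/D)(e/D) + κ(e/D))/D²] de| ≤ (6B₁ + 19/6)(2κ₀ + κ₁)/Λ₂`. [cite: FeldmanSalmhoferTrubowitz1998, §3] -/
theorem twoScaleKernel_antidiagonal_flatness_uv_partner_le {β Λ₁ Λ₂ : ℝ} (hβ : 0 < β) (hΛ₁ : 0 < Λ₁) (hΛ₂ : 0 < Λ₂) {B₁ : ℝ}
    (hB₁ : ∀ x, |deriv salmhoferCutoff x| ≤ B₁) {κ κ' : ℝ → ℝ} {κ₀ κ₁ D : ℝ} (hκb : ∀ t ∈ Icc 0 1, |κ t| ≤ κ₀) (hκ'b : ∀ t ∈ Icc 0 1, |κ' t| ≤ κ₁)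
    (hD : 0 < D) (hDΛ : D ≤ Λ₂ / 4) :
    |∫ e in (0 : ℝ)..D, (ppTwoScaleNumeratorDu β Λ₁ Λ₂ e (D - e) * κ (e / D) / D -
        ppTwoScaleNumerator β Λ₁ Λ₂ e (D - e) * (κ' (e / D) * (e / D) + κ (e / D)) / D ^ 2)| ≤ (6 * B₁ + 19 / 6) * (2 * κ₀ + κ₁) / Λ₂ := by
  have hB0 := salmhoferB₁_nonneg hB₁
  set S : ℝ := (6 * B₁ + 19 / 6) / Λ₂ with hS
  have hS0 : 0 ≤ S := by positivity
  have hκ₀ : 0 ≤ κ₀ := (abs_nonneg _).trans (hκb 0 (left_mem_Icc.2 zero_le_one))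
  have hκ₁ : 0 ≤ κ₁ := (abs_nonneg _).trans (hκ'b 0 (left_mem_Icc.2 zero_le_one))
  have hpt : ∀ e ∈ Ι (0 : ℝ) D, ‖ppTwoScaleNumeratorDu β Λ₁ Λ₂ e (D - e) * κ (e / D) / D -
      ppTwoScaleNumerator β Λ₁ Λ₂ e (D - e) * (κ' (e / D) * (e / D) + κ (e / D)) / D ^ 2‖ ≤ S * (2 * κ₀ + κ₁) / D := fun e he => by
    rw [uIoc_of_le hD.le] at he
    have ht : e / D ∈ Icc (0 : ℝ) 1 := ⟨div_nonneg he.1.le hD.le, (div_le_one hD).2 he.2⟩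
    have hue : 0 ≤ D - e := by linarith [he.2]
    have hueΛ : D - e ≤ Λ₂ / 4 := by linarith [he.1]
    have husq : (D - e) ^ 2 ≤ Λ₂ ^ 2 / 16 := by nlinarith
    have hN := abs_ppTwoScaleNumerator_le_sum_uv hβ hΛ₁ hΛ₂ hB₁ he.1.le hue hueΛ
    rw [add_sub_cancel] at hN
    have hDu := abs_ppTwoScaleNumeratorDu_le_uv hβ hΛ₂ hB₁ (Λ₁ := Λ₁) e husq
    have hk := hκb _ ht
    have hk' := hκ'b _ ht
    rw [Real.norm_eq_abs]
    refine (abs_sub _ _).trans ?_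
    rw [abs_div, abs_div, abs_mul, abs_mul, abs_of_pos hD, abs_of_pos (pow_pos hD 2)]
    have hA : |ppTwoScaleNumeratorDu β Λ₁ Λ₂ e (D - e)| * |κ (e / D)| / D ≤ S * κ₀ / D :=
      div_le_div_of_nonneg_right (mul_le_mul hDu hk (abs_nonneg _) hS0) hD.le
    have hB : |ppTwoScaleNumerator β Λ₁ Λ₂ e (D - e)| * |κ' (e / D) * (e / D) + κ (e / D)| / D ^ 2 ≤ S * D * (κ₁ + κ₀) / D ^ 2 := by
      refine div_le_div_of_nonneg_right (mul_le_mul hN ?_ (abs_nonneg _) (by positivity)) (pow_pos hD 2).le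
      refine (abs_add_le _ _).trans (add_le_add ?_ hk)
      rw [abs_mul, abs_of_nonneg ht.1]
      calc |κ' (e / D)| * (e / D) ≤ κ₁ * 1 := mul_le_mul hk' ht.2 ht.1 hκ₁
        _ = κ₁ := mul_one _
    calc |ppTwoScaleNumeratorDu β Λ₁ Λ₂ e (D - e)| * |κ (e / D)| / D +
          |ppTwoScaleNumerator β Λ₁ Λ₂ e (D - e)| * |κ' (e / D) * (e / D) + κ (e / D)| / D ^ 2
        ≤ S * κ₀ / D + S * D * (κ₁ + κ₀) / D ^ 2 := add_le_add hA hB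
      _ = S * (2 * κ₀ + κ₁) / D := by field_simp; ring
  have h := intervalIntegral.norm_integral_le_of_norm_le_const hpt
  rw [Real.norm_eq_abs, sub_zero, abs_of_pos hD] at h
  refine h.trans (le_of_eq ?_)
  rw [hS]
  field_simp

/-- **UV term, UV weight on the LOOP line** (`N = N_{Λ₂,Λ₁}`, i.e. `ppTwoScaleNumerator β Λ₂ Λ₁`): the same bound for `0 < D ≤ Λ₂/4`
(by the symmetry `N_{Λ₂,Λ₁}(e,u) = N_{Λ₁,Λ₂}(u,e)`, the loop level `e ≤ D ≤ Λ₂/4` is the UV-weighted one). [cite: FeldmanSalmhoferTrubowitz1998, §3] -/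
theorem twoScaleKernel_antidiagonal_flatness_uv_loop_le {β Λ₁ Λ₂ : ℝ} (hβ : 0 < β) (hΛ₁ : 0 < Λ₁) (hΛ₂ : 0 < Λ₂) {B₁ : ℝ}
    (hB₁ : ∀ x, |deriv salmhoferCutoff x| ≤ B₁) {κ κ' : ℝ → ℝ} {κ₀ κ₁ D : ℝ} (hκb : ∀ t ∈ Icc 0 1, |κ t| ≤ κ₀) (hκ'b : ∀ t ∈ Icc 0 1, |κ' t| ≤ κ₁)
    (hD : 0 < D) (hDΛ : D ≤ Λ₂ / 4) :
    |∫ e in (0 : ℝ)..D, (ppTwoScaleNumeratorDu β Λ₂ Λ₁ e (D - e) * κ (e / D) / D -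
        ppTwoScaleNumerator β Λ₂ Λ₁ e (D - e) * (κ' (e / D) * (e / D) + κ (e / D)) / D ^ 2)| ≤ (6 * B₁ + 19 / 6) * (2 * κ₀ + κ₁) / Λ₂ := by
  have hB0 := salmhoferB₁_nonneg hB₁
  set S : ℝ := (6 * B₁ + 19 / 6) / Λ₂ with hS
  have hS0 : 0 ≤ S := by positivity
  have hκ₀ : 0 ≤ κ₀ := (abs_nonneg _).trans (hκb 0 (left_mem_Icc.2 zero_le_one))
  have hκ₁ : 0 ≤ κ₁ := (abs_nonneg _).trans (hκ'b 0 (left_mem_Icc.2 zero_le_one))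
  have hpt : ∀ e ∈ Ι (0 : ℝ) D, ‖ppTwoScaleNumeratorDu β Λ₂ Λ₁ e (D - e) * κ (e / D) / D -
      ppTwoScaleNumerator β Λ₂ Λ₁ e (D - e) * (κ' (e / D) * (e / D) + κ (e / D)) / D ^ 2‖ ≤ S * (2 * κ₀ + κ₁) / D := fun e he => by
    rw [uIoc_of_le hD.le] at he
    have ht : e / D ∈ Icc (0 : ℝ) 1 := ⟨div_nonneg he.1.le hD.le, (div_le_one hD).2 he.2⟩
    have hue : 0 ≤ D - e := by linarith [he.2]
    have heΛ : e ≤ Λ₂ / 4 := he.2.trans hDΛ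
    have hesq : e ^ 2 ≤ Λ₂ ^ 2 / 16 := by nlinarith [he.1]
    -- `N_{Λ₂,Λ₁}(e, D−e) = N_{Λ₁,Λ₂}(D−e, e)` with the UV-weighted level `e ≤ Λ₂/4`
    have hN := abs_ppTwoScaleNumerator_le_sum_uv hβ hΛ₁ hΛ₂ hB₁ hue he.1.le heΛ
    rw [← ppTwoScaleNumerator_symm, sub_add_cancel] at hN
    -- `∂ᵤN_{Λ₂,Λ₁}(e,u) = ppTwoScaleNumeratorDu β Λ₂ Λ₁ e u` is the LOOP-type derivative of `N_{Λ₁,Λ₂}` at `(u, e)`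
    have hDu := abs_ppTwoScaleNumeratorDe_le_uv hβ hΛ₁ hΛ₂ hB₁ (D - e) hesq
    have hk := hκb _ ht
    have hk' := hκ'b _ ht
    rw [Real.norm_eq_abs]
    refine (abs_sub _ _).trans ?_
    rw [abs_div, abs_div, abs_mul, abs_mul, abs_of_pos hD, abs_of_pos (pow_pos hD 2)]
    have hA : |ppTwoScaleNumeratorDu β Λ₂ Λ₁ e (D - e)| * |κ (e / D)| / D ≤ S * κ₀ / D :=
      div_le_div_of_nonneg_right (mul_le_mul hDu hk (abs_nonneg _) hS0) hD.le
    have hB : |ppTwoScaleNumerator β Λ₂ Λ₁ e (D - e)| * |κ' (e / D) * (e / D) + κ (e / D)| / D ^ 2 ≤ S * D * (κ₁ + κ₀) / D ^ 2 := by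
      have hN' : |ppTwoScaleNumerator β Λ₂ Λ₁ e (D - e)| ≤ S * D := by
        refine hN.trans (le_of_eq ?_); rw [hS]
      refine div_le_div_of_nonneg_right (mul_le_mul hN' ?_ (abs_nonneg _) (by positivity)) (pow_pos hD 2).le
      refine (abs_add_le _ _).trans (add_le_add ?_ hk)
      rw [abs_mul, abs_of_nonneg ht.1]
      calc |κ' (e / D)| * (e / D) ≤ κ₁ * 1 := mul_le_mul hk' ht.2 ht.1 hκ₁
        _ = κ₁ := mul_one _
    calc |ppTwoScaleNumeratorDu β Λ₂ Λ₁ e (D - e)| * |κ (e / D)| / D +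
          |ppTwoScaleNumerator β Λ₂ Λ₁ e (D - e)| * |κ' (e / D) * (e / D) + κ (e / D)| / D ^ 2
        ≤ S * κ₀ / D + S * D * (κ₁ + κ₀) / D ^ 2 := add_le_add hA hB
      _ = S * (2 * κ₀ + κ₁) / D := by field_simp; ring
  have h := intervalIntegral.norm_integral_le_of_norm_le_const hpt
  rw [Real.norm_eq_abs, sub_zero, abs_of_pos hD] at h
  refine h.trans (le_of_eq ?_)
  rw [hS]
  field_simp

end Summit.HubbardSuperconductivity.HubbardSuperconductivity.Theorems.C4a

end
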